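import Literature.MathematicalPhysics.QuantumLattice.FermiRG.Salmhofer1998PowerCountingProof
import HarnessLib

/-!
# Salmhofer 1998, Theorem 2 (the `(ε₀β)^{(r-1)d}` bound on the many-fermion Green functions) — PROOF

M. Salmhofer, *Continuous renormalization for fermions and Fermi liquid theory*, Commun. Math. Phys.
**194** (1998) 249–295 = arXiv:cond-mat/9706188 [Salmhofer1998], Theorem 2 (render
`paper:arxiv-cond-mat_9706188` p.20 L163–172, proof L174–200).  This file DISCHARGES the named fact
`Literature.MathematicalPhysics.QuantumLattice.FermiRG.Salmhofer1998.ManyFermionGreenFunctionBound` (licence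
F-087 of the gate-hubbard-kl wave, typed by t7 in `Salmhofer1998Sec2.lean`):

`theorem ManyFermionGreenFunctionBound_holds : ManyFermionGreenFunctionBound`.

We follow the printed proof (p.20 L174–200): "By (5.21) … and Lemma 2, `|det 𝒟_t^{(i-1)}| ≤ (8J₁ε_t)^{i-1}`,
so `Δ₁ ≤ 8J₁ε₀`.  By Lemma 5, `‖Ḋ_t‖ ≤ Δ₂ e^{td}`.  The proof is by induction in `r`, with the inductive
hypothesis `‖G_{mr}(t)‖ ≤ γ_{mr} e^{td(r-1)}`.  The statement is trivial for `r = 1`.  Let `r ≥ 2` … By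
Lemma 1 and (4.14), and since `r₁ + r₂ = r`, `‖Q_{mr}(t)‖ ≤ Δ₂ e^{td(r-1)} ∫dκ_{mr} i² Δ₁^{i-1} γ_{m₁r₁}γ_{m₂r₂}`.
Since `r ≥ 2`, `r - 1 ≥ r/2`, so `∫_0^t ds e^{sd(r-1)} ≤ (2/(dr)) e^{td(r-1)}`, and the hypothesis follows by
integration and by `r ≥ m/4`.  Because `D_t = 0` if `t > log(βε₀)`, (the `(ε₀β)^{(r-1)d}` bound) holds."
Lemma 1 = `DeterminantNormBound_holds`, Lemma 2 = `CovarianceGramBound_holds`; the three covariance inputs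
((5.21), Lemma 5, Proposition 4's vanishing) are hypotheses of the typed fact.  As for Theorem 1
(`Salmhofer1998PowerCountingProof.lean`, whose machinery is reused), the Lean proof supplies the
integrability of `s ↦ Q_{mr}(s | X)` on `[0,t]` (carried through the induction) that the print leaves implicit;
"`r ≥ m/4`" is used in the form `m ≤ m̄(r₁) + m̄(r₂) - 2 ≤ 2r + 2` on the support of `∫dκ_{mr}`, and
"`D_t = 0` for `t > log(βε₀)`" in the form `G_{mr}(t) = G_{mr}(log βε₀)` for `t ≥ log(βε₀)` (`Ḋ_t = 0` there,
being the derivative of the zero function).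

No new definition, no `sorry`, no new named fact: net fact debt `-1`.
-/

noncomputable section

open Finset MeasureTheory Set

namespace Literature.MathematicalPhysics.QuantumLattice.FermiRG

namespace Salmhofer1998

section MainT2

-- `Γ : Type` (not `Type*`): the named facts quantify over `Type`.
variable {Γ : Type} [Fintype Γ] [DecidableEq Γ]

/-- `∫_0^t e^{sa} ds = (e^{ta} - 1)/a` for `a ≠ 0`. [folklore] -/
private theorem integral_exp_mul' {a : ℝ} (ha : a ≠ 0) (t : ℝ) :
    ∫ s in (0 : ℝ)..t, Real.exp (s * a) = (Real.exp (t * a) - 1) / a := by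
  have hderiv : ∀ s ∈ Set.uIcc (0 : ℝ) t,
      HasDerivAt (fun u : ℝ => Real.exp (u * a) / a) (Real.exp (s * a)) s := by
    intro s _
    have h1 : HasDerivAt (fun u : ℝ => u * a) a s := by simpa using (hasDerivAt_id s).mul_const a
    have h3 := h1.exp.div_const a
    rwa [mul_div_assoc, div_self ha, mul_one] at h3
  rw [intervalIntegral.integral_eq_sub_of_hasDerivAt hderiv
    ((Real.continuous_exp.comp (continuous_id.mul continuous_const)).intervalIntegrable _ _)]
  simp [sub_div]

/-- The per-index algebra of the induction step of Theorem 2: with `r₁ + r₂ = r`,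
`Δ₂e^{sd} · γ₁e^{sd(r₁-1)} · γ₂e^{sd(r₂-1)} = e^{sd(r-1)} Δ₂ γ₁ γ₂` ("since `r₁ + r₂ = r`", p.20 L189–193).
[cite: Salmhofer1998, Theorem 2 proof (p.20 L186–193)] -/
theorem step_exponent_identity2 {r r₁ : ℕ} (hr₁ : 1 ≤ r₁) (hr : r₁ + 1 ≤ r) (d : ℕ)
    (c Δ₂ g₁ g₂ s : ℝ) :
    c * (Δ₂ * Real.exp (s * d)) * (g₁ * Real.exp (s * ((d : ℝ) * ((r₁ - 1 : ℕ) : ℝ)))) *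
        (g₂ * Real.exp (s * ((d : ℝ) * ((r - r₁ - 1 : ℕ) : ℝ)))) =
      Real.exp (s * ((d : ℝ) * ((r - 1 : ℕ) : ℝ))) * Δ₂ * (c * g₁ * g₂) := by
  have h1 : ((r₁ - 1 : ℕ) : ℝ) = (r₁ : ℝ) - 1 := by rw [Nat.cast_sub hr₁, Nat.cast_one]
  have h2 : ((r - r₁ - 1 : ℕ) : ℝ) = (r : ℝ) - r₁ - 1 := by
    rw [Nat.cast_sub (by omega), Nat.cast_sub (by omega), Nat.cast_one]
  have h3 : ((r - 1 : ℕ) : ℝ) = (r : ℝ) - 1 := by rw [Nat.cast_sub (by omega), Nat.cast_one]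
  have e2 : Real.exp (s * d) * Real.exp (s * ((d : ℝ) * ((r₁ - 1 : ℕ) : ℝ))) *
      Real.exp (s * ((d : ℝ) * ((r - r₁ - 1 : ℕ) : ℝ))) = Real.exp (s * ((d : ℝ) * ((r - 1 : ℕ) : ℝ))) := by
    rw [← Real.exp_add, ← Real.exp_add, h1, h2, h3]
    congr 1
    ring
  calc c * (Δ₂ * Real.exp (s * d)) * (g₁ * Real.exp (s * ((d : ℝ) * ((r₁ - 1 : ℕ) : ℝ)))) *
        (g₂ * Real.exp (s * ((d : ℝ) * ((r - r₁ - 1 : ℕ) : ℝ))))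
      = (c * Δ₂ * g₁ * g₂) * (Real.exp (s * d) * Real.exp (s * ((d : ℝ) * ((r₁ - 1 : ℕ) : ℝ))) *
          Real.exp (s * ((d : ℝ) * ((r - r₁ - 1 : ℕ) : ℝ)))) := by ring
    _ = (c * Δ₂ * g₁ * g₂) * Real.exp (s * ((d : ℝ) * ((r - 1 : ℕ) : ℝ))) := by rw [e2]
    _ = _ := by ring

/-- "`r ≥ m/4`" (p.20 L196–197) in the form used: a nonempty index set `𝓜_{r₁ r₂ m}` with `m̄(r) ≤ 2r+2`
forces `m ≤ 2r + 2`; so for `m > 2r + 2` the `κ`-sum vanishes. [cite: Salmhofer1998, Theorem 2 proof (p.20 L196–197)] -/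
theorem re_kappaSum_eq_zero_of_lt (mbar : ℕ → ℕ) (hmbar : ∀ r, mbar r ≤ 2 * r + 2) {m r : ℕ}
    (hm : 2 * r + 2 < m) (B : ℕ → ℕ → ℕ → ℕ → ℕ → ℝ) :
    (kappaSum mbar m r fun r₁ m₁ r₂ m₂ i => (B r₁ m₁ r₂ m₂ i : ℂ)).re = 0 := by
  have h0 : (kappaSum mbar m r fun _ _ _ _ _ => ((0 : ℝ) : ℂ)).re = 0 := by
    rw [re_kappaSum_ofReal]; simp
  rw [← h0]
  refine re_kappaSum_congr mbar m r _ _ fun r₁ m₁ m₂ i hr₁ hm₁ hm₂ hM _ _ => ?_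
  exfalso
  have hsp := MIndex_spec hM
  simp only [Finset.mem_Icc] at hr₁ hm₁ hm₂
  have h1 := hmbar r₁
  have h2 := hmbar (r - r₁)
  omega

/-- **Theorem 2, abstract form**: the induction of p.20 L178–197 for an arbitrary finite `Γ`: covariance
`D_t` continuous in `t` with measurable locally bounded derivative `Ḋ_t`, `|det 𝒟_s^{(i)}| ≤ (B e^{-s})^i`
(Lemma 2 with (5.21), `B = 8J₁ε₀`), `‖Ḋ_s‖ ≤ Δ₂e^{sd}` (Lemma 5), degrees `m̄(r) ≤ 2r+2`, and the constant
`A` of the recursion (4.18) dominating `Δ₂/(2d(r-1))·m` on `1 ≤ m ≤ 2r+2`, `r ≥ 2`.  Conclusion: `γ ≥ 0`,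
continuity of `s ↦ G_{mr}(s|X)` on `[0,∞)`, and the inductive hypothesis `‖G_{mr}(t)‖ ≤ γ_{mr} e^{td(r-1)}`
for all `t ≥ 0`. [cite: Salmhofer1998, Theorem 2 proof (p.20 L174–197)] -/
theorem manyFermionBound_core {ε : ℝ} (hε : 0 < ε) (mbar : ℕ → ℕ) (hmbar : ∀ r, mbar r ≤ 2 * r + 2)
    {D Ddot : ℝ → Γ → Γ → ℂ} {B Δ₂ A : ℝ} {d : ℕ} (hd : 1 ≤ d) (hB : 0 ≤ B) (hΔ₂ : 0 ≤ Δ₂) (hA : 0 ≤ A)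
    (hAm : ∀ m r : ℕ, 1 ≤ m → 2 ≤ r → m ≤ 2 * r + 2 →
      Δ₂ / (2 * ((d : ℝ) * ((r - 1 : ℕ) : ℝ))) ≤ A * (1 / (m : ℝ)))
    (hDc : ∀ X X', Continuous fun s => D s X X')
    (hDdot : ∀ (V W : Γ) (b : ℝ), 0 ≤ b → IntervalIntegrable (fun s => Ddot s V W) volume 0 b)
    (hdet : ∀ s : ℝ, 0 ≤ s → ∀ (i : ℕ) (Y Z : Fin i → Γ),
      ‖(covMatrix (D s) Y Z).det‖ ≤ (B * Real.exp (-s)) ^ i)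
    (h15 : ∀ s : ℝ, 0 ≤ s → sNorm ε (twoPt (Ddot s)) ≤ Δ₂ * Real.exp (s * d))
    (G : KernelFamily Γ) (γ : ℕ → ℕ → ℝ) (hG : IsRGESolution ε mbar D Ddot G)
    (hΓ : IsUntruncatedGamma mbar (fun m r => sNorm ε (G m r 0)) A B γ) (r : ℕ) :
    (∀ m, 0 ≤ γ m r) ∧
    (∀ (m : ℕ) (X : Fin m → Γ) (b : ℝ), 0 ≤ b → ContinuousOn (fun s => G m r s X) (Set.Icc 0 b)) ∧
    (∀ (m : ℕ) (t : ℝ), 1 ≤ m → 0 ≤ t →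
      sNorm ε (G m r t) ≤ γ m r * Real.exp (t * ((d : ℝ) * ((r - 1 : ℕ) : ℝ)))) := by
  unfold IsUntruncatedGamma at hΓ
  induction r using Nat.strong_induction_on with
  | _ r IH => ?_
  have hdpos : (0 : ℝ) < d := by exact_mod_cast hd
  -- lower orders: `γ ≥ 0`, norm bounds, continuity
  have hγ0 : ∀ r' < r, ∀ m', 0 ≤ γ m' r' := fun r' hr' m' => (IH r' hr').1 m'
  have hGnorm : ∀ r' < r, ∀ (m' : ℕ) (s : ℝ), 1 ≤ m' → 0 ≤ s →
      sNorm ε (G m' r' s) ≤ γ m' r' * Real.exp (s * ((d : ℝ) * ((r' - 1 : ℕ) : ℝ))) :=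
    fun r' hr' m' s hm hs => (IH r' hr').2.2 m' s hm hs
  have hGcont : ∀ (b : ℝ), 0 ≤ b → ∀ r' < r, ∀ (m' : ℕ) (U : Fin m' → Γ),
      ContinuousOn (fun s => G m' r' s U) (Set.uIcc 0 b) := fun b hb r' hr' m' U => by
    rw [Set.uIcc_of_le hb]; exact (IH r' hr').2.1 m' U b hb
  -- integrability of the integrand of the integral equation at order `r`
  have hq : ∀ (m : ℕ) (Y : Fin m → Γ) (b : ℝ), 0 ≤ b →
      IntervalIntegrable (fun s => quadTerm ε mbar D Ddot G G m r s Y) volume 0 b := fun m Y b hb =>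
    intervalIntegrable_quadTerm ε mbar hDc (fun V W => hDdot V W b hb) m r (hGcont b hb) Y
  -- the constant `K = Re ∫dκ i² B^{i-1} γ γ` of (4.18) and its sign
  have hK0 : ∀ m, 0 ≤ (kappaSum mbar m r fun r₁ m₁ r₂ m₂ i =>
      (((i : ℝ) ^ 2 * B ^ (i - 1) * γ m₁ r₁ * γ m₂ r₂ : ℝ) : ℂ)).re := by
    intro m
    refine re_kappaSum_nonneg mbar m r _ fun r₁ m₁ m₂ i hr₁ _ _ _ _ _ => ?_
    have hr1 : r₁ < r := by simp only [Finset.mem_Icc] at hr₁; omega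
    have hr2 : r - r₁ < r := by simp only [Finset.mem_Icc] at hr₁; omega
    exact mul_nonneg (mul_nonneg (mul_nonneg (sq_nonneg _) (pow_nonneg hB _)) (hγ0 r₁ hr1 m₁))
      (hγ0 (r - r₁) hr2 m₂)
  refine ⟨fun m => ?_, fun m X b hb => ?_, fun m t hm1 ht => ?_⟩
  · -- `γ_{mr} ≥ 0`
    rw [hΓ m r]
    exact add_nonneg (kernelNorm_nonneg hε.le _ _) (mul_nonneg (mul_nonneg hA (by positivity)) (hK0 m))
  · -- continuity of `s ↦ G_{mr}(s | X)` on `[0,b]`, from the integral equation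
    have hF : ∀ π : Equiv.Perm (Fin m), ContinuousOn (fun s => ∫ u in (0 : ℝ)..s,
        quadTerm ε mbar D Ddot G G m r u (X ∘ π)) (Set.Icc 0 b) := by
      intro π
      have := intervalIntegral.continuousOn_primitive_interval' (hq m (X ∘ π) b hb) Set.left_mem_uIcc
      rwa [Set.uIcc_of_le hb] at this
    have hS : ContinuousOn (fun s => ∑ π : Equiv.Perm (Fin m), ((Equiv.Perm.sign π : ℤ) : ℂ) *
        ∫ u in (0 : ℝ)..s, quadTerm ε mbar D Ddot G G m r u (X ∘ π)) (Set.Icc 0 b) :=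
      continuousOn_finsetSum _ fun π _ => continuousOn_const.mul (hF π)
    have hrhs : ContinuousOn (fun s => G m r 0 X + (2 : ℂ)⁻¹ * (((m.factorial : ℝ)⁻¹ : ℝ) •
        ∑ π : Equiv.Perm (Fin m), ((Equiv.Perm.sign π : ℤ) : ℂ) *
          ∫ u in (0 : ℝ)..s, quadTerm ε mbar D Ddot G G m r u (X ∘ π))) (Set.Icc 0 b) :=
      continuousOn_const.add (continuousOn_const.mul (hS.fun_const_smul _))
    exact hrhs.congr fun s hs => by rw [hG m r s hs.1 X]; rfl
  · -- the inductive bound `‖G_{mr}(t)‖ ≤ γ_{mr} e^{td(r-1)}`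
    obtain ⟨n, rfl⟩ : ∃ n, m = n + 1 := ⟨m - 1, by omega⟩
    set K₀ := (kappaSum mbar (n + 1) r fun r₁ m₁ r₂ m₂ i =>
      (((i : ℝ) ^ 2 * B ^ (i - 1) * γ m₁ r₁ * γ m₂ r₂ : ℝ) : ℂ)).re with hK₀_def
    have hK₀ : 0 ≤ K₀ := hK0 (n + 1)
    have hγ : γ (n + 1) r = sNorm ε (G (n + 1) r 0) + A * (1 / ((n + 1 : ℕ) : ℝ)) * K₀ := hΓ (n + 1) r
    have hN0 : 0 ≤ sNorm ε (G (n + 1) r 0) := kernelNorm_nonneg hε.le _ _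
    set a : ℝ := (d : ℝ) * ((r - 1 : ℕ) : ℝ) with ha_def
    have ha0 : 0 ≤ a := by positivity
    -- the slice bound `b(s) = e^{sd(r-1)} Δ₂ K₀`
    have hqb : ∀ s ∈ Set.Icc (0 : ℝ) t, ∀ (p : Fin (n + 1)) (x : Γ),
        ε ^ n * sliceSum (quadTerm ε mbar D Ddot G G (n + 1) r s) p x ≤
          Real.exp (s * a) * (Δ₂ * K₀) := by
      intro s hs p x
      have hs0 : 0 ≤ s := hs.1
      refine (mul_sliceSum_le_kernelNorm ε _ p x).trans ?_
      have L1 := DeterminantNormBound_holds Γ ε hε mbar D Ddot G G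
        (fun i s => (B * Real.exp (-s)) ^ i) s (hdet s hs0) (n + 1) r (by omega)
      refine L1.trans ?_
      have hBe : B * Real.exp (-s) ≤ B := by
        have : Real.exp (-s) ≤ 1 := Real.exp_le_one_iff.mpr (by linarith)
        nlinarith
      calc (kappaSum mbar (n + 1) r fun r₁ m₁ r₂ m₂ i =>
              (((i : ℝ) ^ 2 * (B * Real.exp (-s)) ^ (i - 1) * sNorm ε (twoPt (Ddot s)) *
                sNorm ε (G m₁ r₁ s) * sNorm ε (G m₂ r₂ s) : ℝ) : ℂ)).re
          ≤ (kappaSum mbar (n + 1) r fun r₁ m₁ r₂ m₂ i =>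
              (((i : ℝ) ^ 2 * B ^ (i - 1) * (Δ₂ * Real.exp (s * d)) *
                (γ m₁ r₁ * Real.exp (s * ((d : ℝ) * ((r₁ - 1 : ℕ) : ℝ)))) *
                (γ m₂ r₂ * Real.exp (s * ((d : ℝ) * ((r₂ - 1 : ℕ) : ℝ)))) : ℝ) : ℂ)).re := by
            refine re_kappaSum_mono mbar (n + 1) r _ _ fun r₁ m₁ m₂ i hr₁ hm₁ hm₂ hM _ _ => ?_
            have hr1 : r₁ < r := by simp only [Finset.mem_Icc] at hr₁; omega
            have hr2 : r - r₁ < r := by simp only [Finset.mem_Icc] at hr₁; omega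
            have hm₁1 : 1 ≤ m₁ := (Finset.mem_Icc.mp hm₁).1
            have hm₂1 : 1 ≤ m₂ := (Finset.mem_Icc.mp hm₂).1
            have hc0 : 0 ≤ (i : ℝ) ^ 2 * (B * Real.exp (-s)) ^ (i - 1) :=
              mul_nonneg (sq_nonneg _) (pow_nonneg (mul_nonneg hB (Real.exp_pos _).le) _)
            have hc0' : 0 ≤ (i : ℝ) ^ 2 * B ^ (i - 1) := mul_nonneg (sq_nonneg _) (pow_nonneg hB _)
            have hcc : (i : ℝ) ^ 2 * (B * Real.exp (-s)) ^ (i - 1) ≤ (i : ℝ) ^ 2 * B ^ (i - 1) :=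
              mul_le_mul_of_nonneg_left (pow_le_pow_left₀ (mul_nonneg hB (Real.exp_pos _).le) hBe _)
                (sq_nonneg _)
            have hND0 : 0 ≤ sNorm ε (twoPt (Ddot s)) := kernelNorm_nonneg hε.le _ _
            have hN₁0 : 0 ≤ sNorm ε (G m₁ r₁ s) := kernelNorm_nonneg hε.le _ _
            have hN₂0 : 0 ≤ sNorm ε (G m₂ (r - r₁) s) := kernelNorm_nonneg hε.le _ _
            refine mul_le_mul (mul_le_mul (mul_le_mul hcc (h15 s hs0) hND0 hc0')
              (hGnorm r₁ hr1 m₁ s hm₁1 hs0) hN₁0 (mul_nonneg hc0' (by positivity)))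
              (hGnorm (r - r₁) hr2 m₂ s hm₂1 hs0) hN₂0 ?_
            exact mul_nonneg (mul_nonneg hc0' (by positivity))
              (mul_nonneg (hγ0 r₁ hr1 m₁) (Real.exp_pos _).le)
        _ = (kappaSum mbar (n + 1) r fun r₁ m₁ r₂ m₂ i =>
              ((Real.exp (s * a) * Δ₂ * ((i : ℝ) ^ 2 * B ^ (i - 1) * γ m₁ r₁ * γ m₂ r₂) : ℝ) : ℂ)).re := by
            refine re_kappaSum_congr mbar (n + 1) r _ _ fun r₁ m₁ m₂ i hr₁ _ _ _ _ _ => ?_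
            simp only [Finset.mem_Icc] at hr₁
            rw [ha_def]
            exact step_exponent_identity2 hr₁.1 (by omega) d _ Δ₂ _ _ s
        _ = Real.exp (s * a) * Δ₂ * K₀ := by rw [hK₀_def, ← re_kappaSum_const_mul]
        _ = Real.exp (s * a) * (Δ₂ * K₀) := by ring
    -- one step of the integral equation
    have hstep := kernelNorm_step_le hε (G (n + 1) r t) (G (n + 1) r 0)
      (fun s Y => quadTerm ε mbar D Ddot G G (n + 1) r s Y)
      (fun s => Real.exp (s * a) * (Δ₂ * K₀)) ht
      (fun X => hG (n + 1) r t ht X) (fun Y => hq (n + 1) Y t ht)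
      ((by fun_prop : Continuous fun s : ℝ => Real.exp (s * a) * (Δ₂ * K₀)).intervalIntegrable 0 t)
      (fun s _ => mul_nonneg (Real.exp_pos _).le (mul_nonneg hΔ₂ hK₀)) hqb
    rw [intervalIntegral.integral_mul_const] at hstep
    change sNorm ε (G (n + 1) r t) ≤ sNorm ε (G (n + 1) r 0) +
      2⁻¹ * ((∫ s in (0 : ℝ)..t, Real.exp (s * a)) * (Δ₂ * K₀)) at hstep
    have hC : 0 ≤ Δ₂ * K₀ := mul_nonneg hΔ₂ hK₀
    have hexp1 : 1 ≤ Real.exp (t * a) := Real.one_le_exp (mul_nonneg ht ha0)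
    rcases Nat.lt_or_ge r 2 with hr | hr
    · -- `r ≤ 1`: the `κ`-sum is empty ("trivial")
      have hK00 : K₀ = 0 := by
        rw [hK₀_def, re_kappaSum_ofReal]
        refine Finset.sum_eq_zero fun r₁ hr₁ => ?_
        simp only [Finset.mem_Icc] at hr₁
        omega
      rw [hK00, mul_zero, mul_zero, mul_zero, add_zero] at hstep
      rw [hγ, hK00, mul_zero, add_zero]
      nlinarith [hstep, hN0, hexp1]
    · -- `r ≥ 2`: `∫_0^t e^{sd(r-1)} ≤ e^{td(r-1)}/(d(r-1))` and "`r ≥ m/4`"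
      have ha : 0 < a := by
        rw [ha_def]
        have : (1 : ℝ) ≤ ((r - 1 : ℕ) : ℝ) := by
          have h1 : 1 ≤ r - 1 := by omega
          exact_mod_cast h1
        positivity
      have hI : ∫ s in (0 : ℝ)..t, Real.exp (s * a) = (Real.exp (t * a) - 1) / a := integral_exp_mul' ha.ne' t
      rw [hI] at hstep
      have h1 : 2⁻¹ * ((Real.exp (t * a) - 1) / a * (Δ₂ * K₀)) ≤
          2⁻¹ * (Real.exp (t * a) / a * (Δ₂ * K₀)) :=
        mul_le_mul_of_nonneg_left (mul_le_mul_of_nonneg_right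
          (div_le_div_of_nonneg_right (by linarith) ha.le) hC) (by norm_num)
      have h2 : 2⁻¹ * (Real.exp (t * a) / a * (Δ₂ * K₀)) = (Δ₂ / (2 * a)) * K₀ * Real.exp (t * a) := by
        field_simp
      -- "`r ≥ m/4`": either the `κ`-sum is empty or `m ≤ 2r + 2`
      have h3 : (Δ₂ / (2 * a)) * K₀ ≤ A * (1 / ((n + 1 : ℕ) : ℝ)) * K₀ := by
        by_cases hm : 2 * r + 2 < n + 1
        · have hK00 : K₀ = 0 := by rw [hK₀_def]; exact re_kappaSum_eq_zero_of_lt mbar hmbar hm _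
          rw [hK00, mul_zero, mul_zero]
        · exact mul_le_mul_of_nonneg_right (by rw [ha_def]; exact hAm (n + 1) r (by omega) hr (by omega)) hK₀
      calc sNorm ε (G (n + 1) r t)
          ≤ sNorm ε (G (n + 1) r 0) + (Δ₂ / (2 * a)) * K₀ * Real.exp (t * a) := by linarith [hstep, h1, h2]
        _ ≤ sNorm ε (G (n + 1) r 0) * Real.exp (t * a) + A * (1 / ((n + 1 : ℕ) : ℝ)) * K₀ * Real.exp (t * a) := by
            have := mul_le_mul_of_nonneg_right h3 (Real.exp_pos (t * a)).le
            nlinarith [hN0, hexp1, this]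
        _ = γ (n + 1) r * Real.exp (t * a) := by rw [hγ]; ring

/-- **Salmhofer 1998, Theorem 2** (`‖G_{mr}(t)‖ ≤ γ_{mr} (ε₀β)^{(r-1)d}` for the many-fermion model),
discharging the named fact `ManyFermionGreenFunctionBound` (licence F-087).  Proof:
`manyFermionBound_core` (the induction `‖G_{mr}(t)‖ ≤ γ_{mr}e^{td(r-1)}`), Lemma 2 (`CovarianceGramBound_holds`)
with (5.21) for the determinant bound, `A = 8Δ₂/(ε₀d) ≥ Δ₂ m/(2d(r-1))` on `m ≤ 2r+2` (from `ε₀ ≤ 1`), and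
`G_{mr}(t) = G_{mr}(log βε₀)` for `t ≥ log βε₀` since `Ḋ_t = 0` there.
[cite: Salmhofer1998, Theorem 2 (p.20 L163–200)] -/
theorem ManyFermionGreenFunctionBound_holds : ManyFermionGreenFunctionBound := by
  intro d hd Λ _ _ _ Λs N _ _ _ χ neg εs Dhat D Ddot ε mbar β eps0 J₁ Δ₂ hε heps0 heps1 hβ hJ₁ hΔ₂ hmbar
    hDF hD hD0 h14 h15 G γ hG hΓ
  -- derived data
  have hDc : ∀ X X' : Λ × N × Fin 2, Continuous fun s => D s X X' := fun X X' =>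
    continuous_iff_continuousAt.mpr fun s => (hD s X X').continuousAt
  have hsum0 : ∀ s, 0 ≤ εs * ∑ k : Λs, ‖Dhat s k‖ := fun s =>
    mul_nonneg hDF.εs_pos.le (Finset.sum_nonneg fun _ _ => norm_nonneg _)
  have hB : 0 ≤ 8 * J₁ * eps0 := by positivity
  have hdpos : (0 : ℝ) < d := by exact_mod_cast hd
  have hA : 0 ≤ 8 * Δ₂ / (eps0 * d) := by positivity
  have hdet : ∀ s : ℝ, 0 ≤ s → ∀ (i : ℕ) (Y Z : Fin i → Λ × N × Fin 2),
      ‖(covMatrix (D s) Y Z).det‖ ≤ (8 * J₁ * eps0 * Real.exp (-s)) ^ i := by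
    intro s hs i Y Z
    have h2 := (CovarianceGramBound_holds Λ Λs N χ neg εs Dhat (fun _ => (1 : Matrix N N ℝ)) D hDF s).2
      (i + 1) Y Z
    have h3 : (εs * ∑ k : Λs, ‖Dhat s k‖) ^ (i + 1 - 1) ≤ (8 * J₁ * eps0 * Real.exp (-s)) ^ i := by
      rw [Nat.add_sub_cancel]
      exact pow_le_pow_left₀ (hsum0 s) (h14 s hs) i
    exact h2.trans h3
  have hDdot : ∀ (V W : Λ × N × Fin 2) (b : ℝ), 0 ≤ b →
      IntervalIntegrable (fun s => Ddot s V W) volume 0 b := by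
    intro V W b hb
    have hmeas : AEStronglyMeasurable (fun s => Ddot s V W) (volume.restrict (Set.uIoc 0 b)) := by
      have e : (fun s => Ddot s V W) = deriv (fun s => D s V W) :=
        funext fun s => ((hD s V W).deriv).symm
      rw [e]
      exact (measurable_deriv _).aestronglyMeasurable
    refine IntervalIntegrable.mono_fun' (g := fun _ => ε⁻¹ * (Δ₂ * Real.exp (b * d))) intervalIntegrable_const
      hmeas ?_
    refine (ae_restrict_iff' measurableSet_uIoc).mpr (ae_of_all _ fun s hs => ?_)
    rw [Set.uIoc_of_le hb] at hs
    have hs0 : 0 ≤ s := hs.1.le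
    calc ‖Ddot s V W‖ ≤ ∑ W' : Λ × N × Fin 2, ‖Ddot s V W'‖ :=
          Finset.single_le_sum (f := fun W' => ‖Ddot s V W'‖) (fun _ _ => norm_nonneg _) (Finset.mem_univ W)
      _ ≤ (ε ^ 1)⁻¹ * kernelNorm ε 2 (twoPt (Ddot s)) := sum_norm_twoPt_fst_le hε (Ddot s) V
      _ ≤ ε⁻¹ * (Δ₂ * Real.exp (b * d)) := by
          rw [pow_one]
          refine mul_le_mul_of_nonneg_left ((h15 s hs0).trans ?_) (inv_nonneg.mpr hε.le)
          exact mul_le_mul_of_nonneg_left (Real.exp_le_exp.mpr (by nlinarith [hs.2])) hΔ₂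
  -- `A = 8Δ₂/(ε₀ d)` dominates `Δ₂ m /(2d(r-1))` for `1 ≤ m ≤ 2r+2`, `r ≥ 2` (uses `ε₀ ≤ 1`)
  have hAm : ∀ m r : ℕ, 1 ≤ m → 2 ≤ r → m ≤ 2 * r + 2 →
      Δ₂ / (2 * ((d : ℝ) * ((r - 1 : ℕ) : ℝ))) ≤ 8 * Δ₂ / (eps0 * d) * (1 / (m : ℝ)) := by
    intro m r hm hr hmr
    have hr1 : (1 : ℝ) ≤ ((r - 1 : ℕ) : ℝ) := by
      have h1 : 1 ≤ r - 1 := by omega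
      exact_mod_cast h1
    have hm' : (1 : ℝ) ≤ (m : ℝ) := by exact_mod_cast hm
    have hmr' : (m : ℝ) ≤ 16 * ((r - 1 : ℕ) : ℝ) := by
      have h1 : m ≤ 16 * (r - 1) := by omega
      exact_mod_cast h1
    rw [show 8 * Δ₂ / (eps0 * d) * (1 / (m : ℝ)) = Δ₂ * (8 / (eps0 * d * m)) by field_simp,
      show Δ₂ / (2 * ((d : ℝ) * ((r - 1 : ℕ) : ℝ))) = Δ₂ * (1 / (2 * ((d : ℝ) * ((r - 1 : ℕ) : ℝ)))) by
        field_simp]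
    refine mul_le_mul_of_nonneg_left ?_ hΔ₂
    rw [div_le_div_iff₀ (by positivity) (by positivity)]
    have : eps0 * (m : ℝ) ≤ (m : ℝ) := by nlinarith
    nlinarith [this, hmr', hdpos, hdpos.le]
  -- the induction
  have core := fun r => manyFermionBound_core hε mbar hmbar hd hB hΔ₂ hA hAm hDc hDdot hdet h15 G γ hG hΓ r
  -- `T = log(βε₀) > 0` and `G_{mr}(t) = G_{mr}(T)` for `t ≥ T`
  set T := Real.log (β * eps0) with hT_def
  have hβε : 1 < β * eps0 := by linarith
  have hT0 : 0 < T := Real.log_pos hβε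
  have hDdot0 : ∀ s : ℝ, T < s → ∀ V W : Λ × N × Fin 2, Ddot s V W = 0 := by
    intro s hs V W
    have h1 : HasDerivAt (fun u => D u V W) (Ddot s V W) s := hD s V W
    have h2 : HasDerivAt (fun u => D u V W) 0 s := by
      have hev : (fun u => D u V W) =ᶠ[nhds s] fun _ => (0 : ℂ) := by
        filter_upwards [Ioi_mem_nhds hs] with u hu using hD0 u hu V W
      exact (hasDerivAt_const s (0 : ℂ)).congr_of_eventuallyEq hev
    exact h1.unique h2
  have hq0 : ∀ s : ℝ, T < s → ∀ (m r : ℕ) (Y : Fin m → Λ × N × Fin 2),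
      quadTerm ε mbar D Ddot G G m r s Y = 0 := by
    intro s hs m r Y
    rw [quadTerm_eq_kappaSum_summand]
    unfold kappaSum
    refine Finset.sum_eq_zero fun r₁ _ => Finset.sum_eq_zero fun m₁ _ =>
      Finset.sum_eq_zero fun m₂ _ => Finset.sum_eq_zero fun i _ => ?_
    have : summand ε D Ddot G G s r₁ m₁ (r - r₁) m₂ i m Y = 0 := by
      unfold summand
      split_ifs with h
      · simp [gInt, hDdot0 s hs]
      · rfl
    simp [this]
  have hGT : ∀ (m r : ℕ) (t : ℝ), T ≤ t → ∀ X : Fin m → Λ × N × Fin 2, G m r t X = G m r T X := by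
    intro m r t ht X
    have hq : ∀ Y b, 0 ≤ b → IntervalIntegrable (fun s => quadTerm ε mbar D Ddot G G m r s Y) volume 0 b :=
      fun Y b hb => intervalIntegrable_quadTerm ε mbar hDc (fun V W => hDdot V W b hb) m r
        (fun r' _ m' U => by rw [Set.uIcc_of_le hb]; exact (core r').2.1 m' U b hb) Y
    have hint : ∀ Y, (∫ s in (0 : ℝ)..t, quadTerm ε mbar D Ddot G G m r s Y) =
        ∫ s in (0 : ℝ)..T, quadTerm ε mbar D Ddot G G m r s Y := by
      intro Y
      have h0t : 0 ≤ t := hT0.le.trans ht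
      have hTt : IntervalIntegrable (fun s => quadTerm ε mbar D Ddot G G m r s Y) volume T t :=
        (hq Y t h0t).mono_set (by
          rw [Set.uIcc_of_le ht, Set.uIcc_of_le h0t]
          exact Set.Icc_subset_Icc hT0.le le_rfl)
      rw [← intervalIntegral.integral_add_adjacent_intervals (hq Y T hT0.le) hTt]
      have hz : ∫ s in T..t, quadTerm ε mbar D Ddot G G m r s Y = ∫ _ in T..t, (0 : ℂ) := by
        refine intervalIntegral.integral_congr_ae (ae_of_all _ fun s hs => ?_)
        rw [Set.uIoc_of_le ht] at hs
        exact hq0 s hs.1 m r Y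
      rw [hz, intervalIntegral.integral_zero, add_zero]
    rw [hG m r t (hT0.le.trans ht) X, hG m r T hT0.le X]
    simp only [hint]
  -- conclusion
  intro m r t ht hm hr
  have hγ0 : 0 ≤ γ m r := (core r).1 m
  have hTexp : Real.exp (T * ((d : ℝ) * ((r - 1 : ℕ) : ℝ))) = (eps0 * β) ^ ((r - 1) * d) := by
    have e1 : T * ((d : ℝ) * ((r - 1 : ℕ) : ℝ)) = (((r - 1) * d : ℕ) : ℝ) * T := by push_cast; ring
    rw [e1, Real.exp_nat_mul, hT_def, Real.exp_log (by linarith), mul_comm β eps0]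
  have key : ∀ t', 0 ≤ t' → t' ≤ T → sNorm ε (G m r t') ≤ γ m r * (eps0 * β) ^ ((r - 1) * d) := by
    intro t' ht' ht'T
    refine ((core r).2.2 m t' hm ht').trans ?_
    rw [← hTexp]
    refine mul_le_mul_of_nonneg_left (Real.exp_le_exp.mpr ?_) hγ0
    exact mul_le_mul_of_nonneg_right ht'T (by positivity)
  rcases le_or_gt t T with htT | htT
  · exact key t ht htT
  · have e : G m r t = G m r T := funext fun X => hGT m r t htT.le X
    rw [e]
    exact key T hT0.le le_rfl

end MainT2

end Salmhofer1998

end Literature.MathematicalPhysics.QuantumLattice.FermiRG
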